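import Summits.BirchSwinnertonDyer.BirchSwinnertonDyer.Theorems.ClassRecordThreeCornerAtThreeShimuraWalkFamilyDictionary
import HarnessLib

/-!
# COHERENT generalised Kolyvagin data for a bare family `ys` over a square-free top level: `(d m hm).y = ys m`, and the derived point of
# `y(m∕ℓ)↑` computed in `K[m]` with `(d m).σ, (d m).S` agrees in `E(K̄)` with the derived point of the datum `d (m∕ℓ)` (Gross (4.1) coherence,
# the hypothesis `hcoh` of shim-p1's `h37_of_labels`) — from x11b3-p8's anchor-free coherent tower (cell `bsd-stepL`, seat
# `bsd-stepL-corner3-p2` g8 = WIDTH-LEVER lane B; `--supports stmt-BirchSwinnertonDyer-21420 --as helper`)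

WHY (PORT MAP (P2) §2 (ii): the key relation ∕ McCallum Prop. 4.4 for the family classes from the labels (B4)+(B5) goes through Gross 3.7 in
Kolyvagin–Euler currency, shim-p1's `h37_of_labels`, whose coherence input `hcoh` compares derived points across the levels `m∕ℓ ∣ m`; data chosen
level by level (`ShimuraWalk.exists_familyData_forall_y_eq`, p599103) need not be coherent). THIS FILE: `exists_coherent_familyData_y_eq` — for `K`
imaginary quadratic, a square-free `n` with inert prime factors and ANY `ys : (m : ℕ) → E(K[m])`, data `d m hm : KolyvaginFamilyData W K ι m` at every
`m ∣ n` with (i) `(d m hm).y = ys m`; (ii) COHERENCE of derived points: for `m ∣ n`, `m′ ∣ m`, `k`, `z ∈ E(K[m′])`,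
`derivedPoint_{(d m).σ, k, (d m).S} (z↑) = (derivedPoint_{(d m′).σ, k, (d m′).S} z)↑` in `E(K[m])` and
`(d m).toGeomPoints ((derivedPoint_{m′} z)↑) = (d m′).toGeomPoints (derivedPoint_{m′} z)` in `E(K̄)`; (iii) hence the `hcoh` clause of `h37_of_labels`
verbatim (`jc := toGeomPoints`, `σc := σ`, `Sc := S`, `yc := y`). All from `RingClassTower.exists_coherent_towerData_derivedPoint` (generators
`res_m g_q`, transversal `res_m(T)`, coherent embeddings). HONEST FRAMING: one theorem (no definition, no named fact, no `sorry`); ring-class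
plumbing; nothing about any curve; no stub closes; BSD is not proved by any of this; T7. Credit: x11b3-p8 (tower), tam3-p1 g12 (datum).
References: [cite: GrossLMS1991, §3 (pp. 216–217), §4 (4.1)] [cite: BertoliniDarmon1996, §2.3–2.5].
presearch: not applicable (plumbing over a tree theorem); `lean search 'exists_coherent_familyData'` → none.
-/

set_option autoImplicit false
set_option linter.dupNamespace false

noncomputable section

open scoped Classical

namespace Summit.BirchSwinnertonDyer.BirchSwinnertonDyer.Theorems.ShimuraWalk

open WeierstrassCurve Field NumberField IsDedekindDomain Finset
  Literature.NumberTheory.EllipticCurves Literature.NumberTheory.GaloisRepresentations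
  Literature.NumberTheory.EllipticCurves.RingClassField
  Summit.BirchSwinnertonDyer.Rank1Residual.X11b
  Summit.BirchSwinnertonDyer.Rank1Residual.JET

variable {K : Type} [Field K] [NumberField K] {W : WeierstrassCurve ℚ}

/-- **Coherent family data from a bare family** (see the module docstring). [cite: GrossLMS1991, §3 (σ_ℓ), §4 (4.1) (S, P_n)] -/
theorem exists_coherent_familyData_y_eq (hK : IsImaginaryQuadratic K) (ι : K →+* ℂ) {n : ℕ} (hn : Squarefree n)
    (hinert : ∀ q ∈ n.primeFactors, (Ideal.span {(q : 𝓞 K)}).IsPrime)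
    (ys : (m : ℕ) → (W.baseChange (ringClassField K ι m)).toAffine.Point) :
    ∃ d : (m : ℕ) → m ∣ n → KolyvaginFamilyData W K ι m,
      (∀ (m : ℕ) (hm : m ∣ n), (d m hm).y = ys m) ∧
      (∀ (m : ℕ) (hm : m ∣ n) (m' : ℕ) (hm'm : m' ∣ m)
        (hle : ringClassField K ι m' ≤ ringClassField K ι m) (k : ℕ)
        (z : (W.baseChange (ringClassField K ι m')).toAffine.Point),
        letI : Algebra K ℂ := ι.toAlgebra
        KolyvaginOperator.derivedPoint (pointGalHom W (ringClassField K ι m)) (d m hm).σ k (d m hm).S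
            (WeierstrassCurve.Affine.Point.map (W' := W)
              ((RingClassField.inclusion ι hle).restrictScalars ℚ) z) =
          WeierstrassCurve.Affine.Point.map (W' := W)
              ((RingClassField.inclusion ι hle).restrictScalars ℚ)
            (KolyvaginOperator.derivedPoint (pointGalHom W (ringClassField K ι m'))
              (d m' (hm'm.trans hm)).σ k (d m' (hm'm.trans hm)).S z) ∧
        (d m hm).toGeomPoints
            (WeierstrassCurve.Affine.Point.map (W' := W)
              ((RingClassField.inclusion ι hle).restrictScalars ℚ)
              (KolyvaginOperator.derivedPoint (pointGalHom W (ringClassField K ι m'))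
                (d m' (hm'm.trans hm)).σ k (d m' (hm'm.trans hm)).S z)) =
          (d m' (hm'm.trans hm)).toGeomPoints
            (KolyvaginOperator.derivedPoint (pointGalHom W (ringClassField K ι m'))
              (d m' (hm'm.trans hm)).σ k (d m' (hm'm.trans hm)).S z)) ∧
      (∀ (m : ℕ) (hm : m ∣ n) (ℓ : ℕ) (hℓ : ℓ ∈ m.primeFactors)
        (hle : ringClassField K ι (m / ℓ) ≤ ringClassField K ι m),
        letI : Algebra K ℂ := ι.toAlgebra
        (d m hm).toGeomPoints
            (KolyvaginOperator.derivedPoint (pointGalHom W (ringClassField K ι m)) (d m hm).σ (m / ℓ) (d m hm).S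
              (WeierstrassCurve.Affine.Point.map (W' := W)
                ((RingClassField.inclusion ι hle).restrictScalars ℚ)
                ((d (m / ℓ) ((Nat.div_dvd_of_dvd (Nat.dvd_of_mem_primeFactors hℓ)).trans hm)).y))) =
          (d (m / ℓ) ((Nat.div_dvd_of_dvd (Nat.dvd_of_mem_primeFactors hℓ)).trans hm)).toGeomPoints
            (d (m / ℓ) ((Nat.div_dvd_of_dvd (Nat.dvd_of_mem_primeFactors hℓ)).trans hm)).derivedPoint) := by
  obtain ⟨res, g, T, emb, h1, h2, h3, h4, hβ⟩ :=
    RingClassTower.exists_coherent_towerData_derivedPoint (W := W) hK ι hn hinert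
  let d : (m : ℕ) → m ∣ n → KolyvaginFamilyData W K ι m := fun m hm ↦
    { y := ys m
      σ := fun q ↦ res m (g q)
      zpowers_σ := fun q hq ↦ (h2 m hm q hq).1
      S := T.image (fun t ↦ res m t)
      S_subset := fun s hs ↦ by
        obtain ⟨t, -, rfl⟩ := Finset.mem_image.mp hs
        exact RingClassTower.restrictHom_mem_ringClassGal ι (h1 m hm) t
      S_transversal := h3 m hm
      emb := emb m hm
      emb_apply := h4 m hm }
  have hcoh : ∀ (m : ℕ) (hm : m ∣ n) (m' : ℕ) (hm'm : m' ∣ m)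
      (hle : ringClassField K ι m' ≤ ringClassField K ι m) (k : ℕ)
      (z : (W.baseChange (ringClassField K ι m')).toAffine.Point),
      letI : Algebra K ℂ := ι.toAlgebra
      KolyvaginOperator.derivedPoint (pointGalHom W (ringClassField K ι m)) (d m hm).σ k (d m hm).S
          (WeierstrassCurve.Affine.Point.map (W' := W)
            ((RingClassField.inclusion ι hle).restrictScalars ℚ) z) =
        WeierstrassCurve.Affine.Point.map (W' := W)
            ((RingClassField.inclusion ι hle).restrictScalars ℚ)
          (KolyvaginOperator.derivedPoint (pointGalHom W (ringClassField K ι m'))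
            (d m' (hm'm.trans hm)).σ k (d m' (hm'm.trans hm)).S z) ∧
      (d m hm).toGeomPoints
          (WeierstrassCurve.Affine.Point.map (W' := W)
            ((RingClassField.inclusion ι hle).restrictScalars ℚ)
            (KolyvaginOperator.derivedPoint (pointGalHom W (ringClassField K ι m'))
              (d m' (hm'm.trans hm)).σ k (d m' (hm'm.trans hm)).S z)) =
        (d m' (hm'm.trans hm)).toGeomPoints
          (KolyvaginOperator.derivedPoint (pointGalHom W (ringClassField K ι m'))
            (d m' (hm'm.trans hm)).σ k (d m' (hm'm.trans hm)).S z) :=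
    fun m hm m' hm'm hle k z ↦ hβ m hm m' hm'm hle k z
  refine ⟨d, fun m hm ↦ rfl, hcoh, fun m hm ℓ hℓ hle ↦ ?_⟩
  have hm' : m / ℓ ∣ m := Nat.div_dvd_of_dvd (Nat.dvd_of_mem_primeFactors hℓ)
  obtain ⟨hi, hii⟩ := hcoh m hm (m / ℓ) hm' hle (m / ℓ) (ys (m / ℓ))
  rw [hi, hii]
  rfl

end Summit.BirchSwinnertonDyer.BirchSwinnertonDyer.Theorems.ShimuraWalk

end
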